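import Summits.Ventures.HSemireg.WeilFrameIntrinsic
import Literature.AlgebraicGeometry.HodgeTheory.DegreeOneHodgeTypes

/-!
# Venture HSemireg — the Weil blocks ARE the eigenspaces of an endomorphism: THEOREM R on the real carriers for an abelian
# `2n`-fold of Weil type `(n, n)` given by its `K`-multiplicities (van Geemen 4.9), no frame and no block by value

HONEST FRAMING. Part of the Lean index of the computation cell `pub-hsemireg` (seat w3-mod4-1 gen 8, W3 SPECIAL FIBRES,
MOD4-OFFSPLIT §13). The tree's real carriers (`AbelianVariety ℂ`, `complexBetti`, `hodgeOneZero` / `hodgeZeroOne`,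
`totalExteriorClass`, `contractionRank`) and the Literature layer `HodgeTheory/DegreeOneHodgeTypes` (the `K`-multiplicities
`p_μ = dim (V_μ ∩ H^{1,0})`, `q_μ = dim (V_μ ∩ H^{0,1})` of an endomorphism) ONLY: no semiregularity map is constructed;
nothing here says that HC / HC_CM / HC_AV holds; nothing here is a claim about any explicit variety; the polarisation 2-vector
`Θ` and the Weil vectors stay BY VALUE (in the intrinsic form of `WeilFrameIntrinsic.lean`); no Literature fact is declared.

WHAT IS PROVED. In `contractionRank_weilDatum` the two blocks `P`, `Q ⊆ H¹(A; ℂ)` were abstract. Here they are the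
EIGENSPACES `V_μ`, `V_{μ̄}` of `g^*` on `H¹(A; ℂ)` for an endomorphism `g` of the variety and a non-real eigenvalue `μ` (named
through the hypotheses `hP : P = V_μ`, `hQ : Q = V_{μ̄}`), and ALL block hypotheses of the Weil datum — `V_μ`, `V_{μ̄}` disjoint, of
dimension `2n`, meeting `H^{0,1}` in dimension `n` — follow from the two `K`-MULTIPLICITIES `p_μ = q_μ = n` («Weil type `(n, n)`»,
van Geemen LNM 1594, 4.9) by the tree's `finrank_eigenspace_eq_add` / `finrank_eigenspace_inf_hodgeZeroOne_eq` (`q_{μ̄} = p_μ`)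
and Mathlib's independence of eigenspaces: `weilBlocks_of_multiplicities`. Hence **`contractionRank_weilType`**: for a complex
abelian variety `A` of dimension `2n ≥ 6`, an endomorphism `g` of `A.X`, a non-real `μ` with `p_μ = q_μ = n`, a 2-vector `Θ` in
the span of the Weil generating set of `(H^{0,1}; V_μ, V_{μ̄})`, non-degenerate on `(H^{0,1})^⊥` («the polarisation,
`k`-compatible»), and a total class `Σ_{m ≤ 2n} (q_m/m!) Θ^m + w₊ + w₋` with `w₊`, `w₋` non-zero members of the top lines of
`V_μ`, `V_{μ̄}` («`f(h) + ` a `W_K`-alive part»), `contractionRank A κ = 4n² + n²·rank H₂(q) - 2n = (4 + ρ)n² - 2n`; and the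
Weil-field form **`contractionRank_weilType_of_sq_eq_neg`** for `φ : A ⟶ A` with `φ ≫ φ = -(d • 𝟙 A)`, `d ≥ 1`, `μ = i√d`, where
ONE multiplicity `p_μ = n` suffices (`dim V_μ = 2n` is the tree's `two_mul_finrank_eigenspace_eq`). Everything PROVED, 0 sorry;
NO definition is introduced.
References: [vanGeemen1994HodgeAV] 4.9, Lemma 5.2; [BuchweitzFlenner2008HH] Prop. 6.4.4; [MumfordAV1970] §1 (4), §4 (iii).
-/

noncomputable section

open CliffordAlgebra (contractLeft)
open ExteriorAlgebra (ι)
open Module CategoryTheory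
open Literature.AlgebraicGeometry.Motives Literature.AlgebraicGeometry.HodgeTheory

namespace Summit.Ventures.HSemireg.WeilFrame

open Summit.Ventures.HSemireg.Wedge.Hankel

variable {A : AbelianVariety ℂ}

/-- **the Weil blocks from the `K`-multiplicities:** for an endomorphism `g` of `A.X`, a non-real eigenvalue `μ`, and the
eigenspaces `P = V_μ`, `Q = V_{μ̄}` of `g^*` on `H¹(A; ℂ)` with `p_μ = dim (P ∩ H^{1,0}) = n` and `q_μ = dim (P ∩ H^{0,1}) = n`:
`P`, `Q` are disjoint, of dimension `2n` each, and meet `H^{0,1}` in dimension `n` each. [cite: vanGeemen1994HodgeAV, 4.9] -/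
theorem weilBlocks_of_multiplicities (hA : IsSmoothProjective A.dim A.X) (g : A.X ⟶ A.X) {μ : ℂ}
    (hμ : (starRingEnd ℂ) μ ≠ μ) {P Q : Submodule ℂ (complexBetti A.X 1)}
    (hP : P = Module.End.eigenspace (complexBetti.map g 1).hom μ)
    (hQ : Q = Module.End.eigenspace (complexBetti.map g 1).hom ((starRingEnd ℂ) μ)) {n : ℕ}
    (hp : finrank ℂ ↥(P ⊓ hodgeOneZero hA) = n) (hq : finrank ℂ ↥(P ⊓ hodgeZeroOne hA) = n) :
    Disjoint P Q ∧ finrank ℂ ↥P = n + n ∧ finrank ℂ ↥Q = n + n ∧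
      finrank ℂ ↥(hodgeZeroOne hA ⊓ P) = n ∧ finrank ℂ ↥(hodgeZeroOne hA ⊓ Q) = n := by
  haveI : Module.Finite ℂ (complexBetti A.X 1) := abelianVarietyCohomologyExteriorH1_holds.finite_one A
  subst hP hQ
  set G := (complexBetti.map g 1).hom
  -- q_{μ̄} = p_μ = n and p_{μ̄} = q_μ = n
  have hq' : finrank ℂ ↥(Module.End.eigenspace G ((starRingEnd ℂ) μ) ⊓ hodgeZeroOne hA) = n := by
    rw [finrank_eigenspace_inf_hodgeZeroOne_eq hA g μ, hp]
  have hp' : finrank ℂ ↥(Module.End.eigenspace G ((starRingEnd ℂ) μ) ⊓ hodgeOneZero hA) = n := by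
    rw [← finrank_eigenspace_inf_hodgeZeroOne_eq hA g ((starRingEnd ℂ) μ), starRingEnd_self_apply, hq]
  refine ⟨(Module.End.eigenspaces_iSupIndep G).pairwiseDisjoint (Ne.symm hμ), ?_, ?_, ?_, ?_⟩
  · rw [finrank_eigenspace_eq_add hA g μ, hp, hq]
  · rw [finrank_eigenspace_eq_add hA g ((starRingEnd ℂ) μ), hp', hq']
  · rw [inf_comm, hq]
  · rw [inf_comm, hq']

/-- **THEOREM R on the real carriers for Weil type `(n, n)` given by multiplicities** (`n ≥ 3`): `A` a complex abelian
variety of dimension `2n`, `g` an endomorphism of `A.X` with a non-real eigenvalue `μ` on `H¹(A; ℂ)`, `P = V_μ`, `Q = V_{μ̄}` its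
eigenspaces with `K`-multiplicities `p_μ = q_μ = n`; `Θ` in the span of the Weil generating set of `(H^{0,1}; P, Q)`, non-degenerate
on `(H^{0,1})^⊥`; total class `Σ_{m ≤ 2n} (q_m/m!) Θ^m + w₊ + w₋` with `w₊`, `w₋` non-zero in the top lines of `P`, `Q`. Then
`contractionRank A κ = 4n² + n²·rank H₂(q) - 2n`. [cite: vanGeemen1994HodgeAV, 4.9] [cite: BuchweitzFlenner2008HH, Prop. 6.4.4] -/
theorem contractionRank_weilType (hA : IsSmoothProjective A.dim A.X) (κ : ∀ p : ℕ, complexBetti A.X (2 * p)) {n : ℕ}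
    (hn : 3 ≤ n) (hdim : A.dim = n + n) (g : A.X ⟶ A.X) {μ : ℂ} (hμ : (starRingEnd ℂ) μ ≠ μ)
    {P Q : Submodule ℂ (complexBetti A.X 1)} (hP : P = Module.End.eigenspace (complexBetti.map g 1).hom μ)
    (hQ : Q = Module.End.eigenspace (complexBetti.map g 1).hom ((starRingEnd ℂ) μ))
    (hp : finrank ℂ ↥(P ⊓ hodgeOneZero hA) = n) (hq : finrank ℂ ↥(P ⊓ hodgeZeroOne hA) = n)
    {Θ wP wQ : ExteriorAlgebra ℂ (complexBetti A.X 1)}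
    (hΘ : Θ ∈ Submodule.span ℂ {z : ExteriorAlgebra ℂ (complexBetti A.X 1) | ∃ x l : complexBetti A.X 1,
      ((x ∈ P ∧ l ∈ hodgeZeroOne hA ⊓ Q) ∨ (x ∈ Q ∧ l ∈ hodgeZeroOne hA ⊓ P)) ∧ z = ι ℂ x * ι ℂ l})
    (hnd : ∀ l ∈ (hodgeZeroOne hA : Set (complexBetti A.X 1)), ι ℂ l ∈ Submodule.span ℂ
      {y : ExteriorAlgebra ℂ (complexBetti A.X 1) |
        ∃ φ ∈ {θ : Module.Dual ℂ (complexBetti A.X 1) | ∀ v ∈ hodgeZeroOne hA, θ v = 0}, y = contractLeft φ Θ})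
    (hwP : wP ∈ (⋀[ℂ]^(finrank ℂ ↥P) ↥P).map (ExteriorAlgebra.map P.subtype).toLinearMap) (hwP0 : wP ≠ 0)
    (hwQ : wQ ∈ (⋀[ℂ]^(finrank ℂ ↥Q) ↥Q).map (ExteriorAlgebra.map Q.subtype).toLinearMap) (hwQ0 : wQ ≠ 0) (q : ℕ → ℂ)
    (hx : totalExteriorClass A κ =
      (∑ m ∈ Finset.range (n + n + 1), (q m * ((m.factorial : ℕ) : ℂ)⁻¹) • Θ ^ m) + wP + wQ) :
    contractionRank A κ = ((4 * (n * n) + n * n * (hankel1 ℂ (n + n) 2 q).rank - 2 * n : ℕ) : Cardinal) := by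
  obtain ⟨hPQ, hP2, hQ2, hLP, hLQ⟩ := weilBlocks_of_multiplicities hA g hμ hP hQ hp hq
  exact contractionRank_weilDatum hA κ hn hdim hPQ hLQ hLP hP2 hQ2 hΘ hnd hwP hwP0 hwQ hwQ0 q hx

/-- `conj (i√d) = -(i√d) ≠ i√d` for `d ≥ 1`. -/
lemma conj_I_mul_sqrt {d : ℕ} (hd : 0 < d) :
    (starRingEnd ℂ) (Complex.I * (Real.sqrt d : ℂ)) = -(Complex.I * (Real.sqrt d : ℂ)) ∧
      (starRingEnd ℂ) (Complex.I * (Real.sqrt d : ℂ)) ≠ Complex.I * (Real.sqrt d : ℂ) := by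
  have hc : (starRingEnd ℂ) (Complex.I * (Real.sqrt d : ℂ)) = -(Complex.I * (Real.sqrt d : ℂ)) := by
    rw [map_mul, Complex.conj_I, Complex.conj_ofReal, neg_mul]
  refine ⟨hc, ?_⟩
  rw [hc]
  intro h
  have h2 : (2 : ℂ) * (Complex.I * (Real.sqrt d : ℂ)) = 0 := by
    rw [two_mul]; nth_rewrite 1 [← h]; rw [neg_add_cancel]
  have hs : (Real.sqrt d : ℂ) ≠ 0 :=
    Complex.ofReal_ne_zero.mpr (Real.sqrt_ne_zero'.mpr (Nat.cast_pos.mpr hd))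
  exact (mul_ne_zero two_ne_zero (mul_ne_zero Complex.I_ne_zero hs)) h2

/-- **THEOREM R on the real carriers for an abelian `2n`-fold of WEIL TYPE `(n, n)` in the tree's Weil-field form**
(`n ≥ 3`): `φ : A ⟶ A` with `φ ≫ φ = -(d • 𝟙 A)`, `d ≥ 1`; `P = V₊ = ker(φ^* - i√d)`, `Q = V₋ = ker(φ^* + i√d) ⊆ H¹(A; ℂ)` (so
`dim V± = 2n`, the tree's `two_mul_finrank_eigenspace_eq`), and ONE multiplicity `p_{i√d} = dim (P ∩ H^{1,0}) = n` (balanced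
Weil type); `Θ`, `w₊`, `w₋` and the total class as in `contractionRank_weilType`. Then
`contractionRank A κ = 4n² + n²·rank H₂(q) - 2n = (4 + ρ)n² - 2n`.
[cite: vanGeemen1994HodgeAV, 4.9 and Lemma 5.2] [cite: BuchweitzFlenner2008HH, Prop. 6.4.4] [cite: MumfordAV1970, §1 (4) and §4 (iii)] -/
theorem contractionRank_weilType_of_sq_eq_neg (hA : IsSmoothProjective A.dim A.X)
    (κ : ∀ p : ℕ, complexBetti A.X (2 * p)) {n d : ℕ} (hn : 3 ≤ n) (hdim : A.dim = n + n) (hd : 0 < d) {φ : A ⟶ A}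
    (hφ : φ ≫ φ = -(d • 𝟙 A)) {P Q : Submodule ℂ (complexBetti A.X 1)}
    (hP : P = Module.End.eigenspace (complexBetti.map φ.hom.hom.hom 1).hom (Complex.I * (Real.sqrt d : ℂ)))
    (hQ : Q = Module.End.eigenspace (complexBetti.map φ.hom.hom.hom 1).hom (-(Complex.I * (Real.sqrt d : ℂ))))
    (hp : finrank ℂ ↥(P ⊓ hodgeOneZero hA) = n) {Θ wP wQ : ExteriorAlgebra ℂ (complexBetti A.X 1)}
    (hΘ : Θ ∈ Submodule.span ℂ {z : ExteriorAlgebra ℂ (complexBetti A.X 1) | ∃ x l : complexBetti A.X 1,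
      ((x ∈ P ∧ l ∈ hodgeZeroOne hA ⊓ Q) ∨ (x ∈ Q ∧ l ∈ hodgeZeroOne hA ⊓ P)) ∧ z = ι ℂ x * ι ℂ l})
    (hnd : ∀ l ∈ (hodgeZeroOne hA : Set (complexBetti A.X 1)), ι ℂ l ∈ Submodule.span ℂ
      {y : ExteriorAlgebra ℂ (complexBetti A.X 1) |
        ∃ ψ ∈ {θ : Module.Dual ℂ (complexBetti A.X 1) | ∀ v ∈ hodgeZeroOne hA, θ v = 0}, y = contractLeft ψ Θ})
    (hwP : wP ∈ (⋀[ℂ]^(finrank ℂ ↥P) ↥P).map (ExteriorAlgebra.map P.subtype).toLinearMap) (hwP0 : wP ≠ 0)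
    (hwQ : wQ ∈ (⋀[ℂ]^(finrank ℂ ↥Q) ↥Q).map (ExteriorAlgebra.map Q.subtype).toLinearMap) (hwQ0 : wQ ≠ 0) (q : ℕ → ℂ)
    (hx : totalExteriorClass A κ =
      (∑ m ∈ Finset.range (n + n + 1), (q m * ((m.factorial : ℕ) : ℂ)⁻¹) • Θ ^ m) + wP + wQ) :
    contractionRank A κ = ((4 * (n * n) + n * n * (hankel1 ℂ (n + n) 2 q).rank - 2 * n : ℕ) : Cardinal) := by
  haveI : Module.Finite ℂ (complexBetti A.X 1) := abelianVarietyCohomologyExteriorH1_holds.finite_one A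
  obtain ⟨hc, hμ⟩ := conj_I_mul_sqrt hd
  -- the second multiplicity: q_μ = dim V₊ - p_μ = 2n - n (term-level, no restated atoms)
  have hq : finrank ℂ ↥(P ⊓ hodgeZeroOne hA) = n := by
    subst hP
    have h := finrank_eigenspace_eq_add hA φ.hom.hom.hom (Complex.I * (Real.sqrt d : ℂ))
    rw [hp] at h
    have h2 := two_mul_finrank_eigenspace_eq hd hφ
    rw [Literature.AlgebraicGeometry.Motives.AbelianVariety.finrank_complexBetti_one, hdim] at h2
    have h3 := Nat.eq_of_mul_eq_mul_left (by norm_num : 0 < 2) h2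
    exact (Nat.add_left_cancel (h3.symm.trans h)).symm
  rw [← hc] at hQ
  exact contractionRank_weilType hA κ hn hdim φ.hom.hom.hom hμ hP hQ hp hq hΘ hnd hwP hwP0 hwQ hwQ0 q hx

end Summit.Ventures.HSemireg.WeilFrame

end
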